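import Mathlib
import Literature.Analysis.FluidPDE.SelfSimilar
import Literature.Analysis.FluidPDE.AxisymmetricEuler
import Literature.Analysis.FluidPDE.AxisymmetricVorticityTransport
import Literature.Analysis.FluidPDE.GavrilovLocalisation
import Literature.Analysis.FluidPDE.OseenZoomCovariance
import Literature.Analysis.FluidPDE.KNSSRegularityGalileanProofs
import Literature.Analysis.FluidPDE.KNSSOseenMildDecayTools
import Literature.Analysis.FluidPDE.KNSSTypeIRateLiouvilleMild
import Literature.Analysis.FluidPDE.OseenMildUniqueness
import Summits.NavierStokesRegularity.NavierStokesRegularity.Theorems.TypeILiouvilleTypeIliouvilleLOseenGauge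
import Summits.NavierStokesRegularity.NavierStokesRegularity.Theorems.TypeILiouvilleTypeIliouvilleLStubOseenConstBoost
import Summits.NavierStokesRegularity.NavierStokesRegularity.Theorems.UnthreadedDoorCellFluxSpaceTimeAnalyticityModGauge
import HarnessLib

/-!
# Crux `PoloidalLiouville` (stmt-NavierStokesRegularity-1222, W1), crux idea «silent-shells» (ns-idea-15):
# ingredient (I2″) `GalileanAxisymmetryPropagates` — axisymmetry of ONE slice propagates to ALL slices, modulo the
# Galilean gauge of the duality class

The sketch `Cruxes/PoloidalLiouville/SilentShellsSketch.lean` (v1.4, l.866) types the gauge-covariant repair I2″ of the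
refuted I2 (`axisymmetryPropagates_false_as_typed`: parasitic drift gauge) as

`GalileanAxisymmetryPropagates : ∀ v, IsBoundedAncientMildSolution 1 v → (∀ t < 0, AEStronglyMeasurable (v t) volume) →
   ContDiffOn ℝ ⊤ (uncurry v) (Iio 0 ×ˢ univ) → (∃ t₁ < 0, IsAxisymmetric (v t₁)) →
   ∃ A c : ℝ → ℝ³, IsBoundedAncientMildSolution 1 (fun t x => v t (x + A t) - c t) ∧
     (∀ t < 0, AEStronglyMeasurable (fun x => v t (x + A t) - c t) volume) ∧ ∀ t < 0, IsAxisymmetric (fun x => v t (x + A t) - c t)`.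

This file PROVES it, body verbatim (`galileanAxisymmetryPropagates`), following the critic's recipe (ns-wall-crit-1 g4, V23
addendum #2, incl. the constant-boost SUBTLETY) over tree theorems only:

* **Oseen gauge** (`Theorems.oseen_gauge_of_aestronglyMeasurable`, crux `TypeIliouvilleL`): `v t x = w t (x − A₀ t) + c₀ t`
  a.e. per slice, `w` continuous, uniformly bounded, weakly divergence free, pointwise Oseen-mild for all `s < t < 0`;
  both sides are continuous in `x` under the smoothness binder, so the representation holds EVERYWHERE;
* **constant Galilean boost + translation** (`Theorems.stub_oseen_const_boost`, `heatExtension_comp_add_right_apply`,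
  `oseenDuhamel_comp_add_right`, `IsWeaklyDivFree.comp_add_right'`): with `c⊥` the horizontal part of `c₀ t₁` the field
  `w₂ t y = w t (y − A₀ t₁ + (t₁ − t) • c⊥) + c⊥` is again in the Oseen-mild class and `w₂ t₁ = v t₁ − c∥` IS axisymmetric
  (`c∥ = (c₀ t₁)₂ e₂` is fixed by the rotations) — `oseenMild_boost_translate`;
* **forward** (`isAxisymmetric_forward_of_oseenMild`): for `t₁ < t < 0` the rotated field `R_θ⁻¹ ∘ w₂ t ∘ R_θ` is Oseen-mild
  from the same datum (`heatExtension_conj_linearIsometryEquiv`, `oseenDuhamel_symm_conj_linearIsometryEquiv`), so uniqueness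
  of bounded Oseen-mild solutions (`oseenMild_bounded_unique`) and continuity give `w₂ t` axisymmetric;
* **backward** (`isAxisymmetric_of_analyticOnNhd_of_Ioo`): `uncurry w₂` is JOINTLY real-analytic on `(−∞,0) × ℝ³` (HH-0⁺'s key
  lemma `CellFlux.oseenGauge_analyticOnNhd_uncurry`, p700714, composed with the affine Galilean chart), so for fixed
  `(θ, y)` the map `t ↦ w₂ t (R_θ y) − R_θ (w₂ t y)` is real-analytic on the preconnected `(−∞,0)` and vanishes on
  `(t₁, 0)`, hence everywhere (identity theorem `AnalyticOnNhd.eqOn_zero_of_preconnected_of_eventuallyEq_zero`);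
* **class**: `w₂` is in the duality class by `isBoundedAncientMildSolution_of_oseen` (Lemarié-Rieusset Thm 6.1, tree), and
  `w₂ t = fun x => v t (x + A t) - c t` for every `t < 0` with `A t = A₀ t − A₀ t₁ + (t₁ − t) • c⊥`, `c t = c₀ t − c⊥`.

With I1′ = HH-0 (`NetFlux.nsSpatialAnalyticity`) and the tree's KNSS Thm 5.2, the sketch's v1.4 glue
`localAxisTrigger0_of_gauge'` now makes `LocalAxisTrigger0` UNCONDITIONAL (custodian one-liner).  Nothing here is a
statement about Navier–Stokes regularity, which is NOT proved; `PoloidalLiouville` (1222) stays OPEN.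
`--supports stmt-NavierStokesRegularity-1222 --as helper`; 0 kit.  [folklore]
-/

-- the summit and its single problem share the name (D-0017 nested layout)
set_option linter.dupNamespace false

noncomputable section

open Set Function Filter Topology Metric MeasureTheory
open scoped Topology ENNReal
open Literature.Analysis Literature.Analysis.FluidPDE

namespace Summit.NavierStokesRegularity.NavierStokesRegularity.Theorems.PoloidalLiouville.SilentShells

open Summit.NavierStokesRegularity.NavierStokesRegularity.Theorems

open Summit.NavierStokesRegularity.NavierStokesRegularity.Theorems.PoloidalLiouville.NetFlux (E3)

namespace GalileanPropagation

/-! ### Small rotation facts -/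

/-- The rotations about the axis fix the axial vectors `r e₂`. [folklore] -/
theorem rotZ_single_two (θ r : ℝ) : rotZ θ (EuclideanSpace.single 2 r) = EuclideanSpace.single 2 r := by
  ext i
  fin_cases i <;> simp

/-- A field that differs from an axisymmetric one by an AXIAL constant is axisymmetric. [folklore] -/
theorem isAxisymmetric_sub_single {u : E3 → E3} (hu : IsAxisymmetric u) (r : ℝ) :
    IsAxisymmetric (fun x => u x - EuclideanSpace.single 2 r) := by
  intro θ x
  show u (rotZ θ x) - EuclideanSpace.single 2 r = rotZ θ (u x - EuclideanSpace.single 2 r)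
  rw [Gavrilov.rotZ_sub, rotZ_single_two, hu θ x]

/-! ### The Oseen-mild class under rotations: forward propagation of axisymmetry by uniqueness -/

/-- **Forward propagation of axisymmetry in the Oseen-mild class.**  Let `w` be continuous and uniformly bounded on
`(−∞,0) × E3` and pointwise Oseen-mild for all `s < t < 0`.  If the slice `w t₁` (`t₁ < 0`) is axisymmetric, so is every
later slice `w t`, `t₁ < t < 0`: the conjugated field `R_θ⁻¹ ∘ w τ ∘ R_θ` is Oseen-mild from the SAME datum at `t₁`
(rotation covariance of the heat semigroup and of the Oseen tensor), so the two agree a.e. by uniqueness of bounded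
Oseen-mild solutions and everywhere by continuity. [folklore] -/
theorem isAxisymmetric_forward_of_oseenMild {w : ℝ → E3 → E3} {K : ℝ}
    (hc : ContinuousOn (uncurry w) (Iio 0 ×ˢ univ)) (hK : ∀ t < 0, ∀ x, ‖w t x‖ ≤ K)
    (hmild : ∀ s t : ℝ, s < t → t < 0 → ∀ x,
      w t x = UnboundedOperators.heatExtension (w s) (t - s) x - oseenDuhamel 1 s w w t x)
    {t₁ : ℝ} (hax : IsAxisymmetric (w t₁)) {t : ℝ} (ht₁t : t₁ < t) (ht : t < 0) :
    IsAxisymmetric (w t) := by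
  intro θ y
  set R : E3 ≃ₗᵢ[ℝ] E3 := rotZLIE θ with hR
  -- the conjugated field
  set wR : ℝ → E3 → E3 := fun τ x => R.symm (w τ (R x)) with hwR
  have hslice : ∀ τ < 0, Continuous (w τ) := fun τ hτ =>
    hc.comp_continuous (Continuous.prodMk_right τ) fun x => ⟨hτ, mem_univ _⟩
  have hsliceR : ∀ τ < 0, Continuous (wR τ) := fun τ hτ =>
    R.symm.continuous.comp ((hslice τ hτ).comp R.continuous)
  -- same datum at `t₁`
  have hdatum : wR t₁ = w t₁ := by
    funext x
    simp only [hwR, hR, rotZLIE_symm_apply, rotZLIE_apply]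
    rw [hax θ x, Gavrilov.rotZ_neg_rotZ]
  -- the conjugated field is Oseen-mild from `t₁`
  have hmildR : ∀ τ : ℝ, t₁ < τ → τ < 0 → ∀ x,
      wR τ x = UnboundedOperators.heatExtension (wR t₁) (τ - t₁) x - oseenDuhamel 1 t₁ wR wR τ x := by
    intro τ h1 h2 x
    have hheat := heatExtension_conj_linearIsometryEquiv R.symm (w t₁) (τ - t₁) x
    simp only [LinearIsometryEquiv.symm_symm] at hheat
    have hos := oseenDuhamel_symm_conj_linearIsometryEquiv R 1 t₁ w w τ x
    have e1 : wR τ x = R.symm (w τ (R x)) := rfl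
    have e2 : UnboundedOperators.heatExtension (wR t₁) (τ - t₁) x =
        R.symm (UnboundedOperators.heatExtension (w t₁) (τ - t₁) (R x)) := hheat
    have e3 : oseenDuhamel 1 t₁ wR wR τ x = R.symm (oseenDuhamel 1 t₁ w w τ (R x)) := hos
    rw [e1, hmild t₁ τ h1 h2 (R x), map_sub, e2, e3]
  -- uniqueness of bounded Oseen-mild solutions on `(t₁, 0)`
  set M : ℝ := max K 0 with hM
  have hM0 : 0 ≤ M := le_max_right _ _
  have hstrip : Ioo t₁ 0 ×ˢ (univ : Set E3) ⊆ Iio 0 ×ˢ univ := prod_mono (fun τ hτ => hτ.2) Subset.rfl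
  have hcR : ContinuousOn (uncurry wR) (Iio 0 ×ˢ univ) := by
    have h1 : ContinuousOn (fun p : ℝ × E3 => uncurry w (p.1, R p.2)) (Iio 0 ×ˢ univ) :=
      hc.comp (continuous_fst.prodMk (R.continuous.comp continuous_snd)).continuousOn
        fun p hp => ⟨hp.1, mem_univ _⟩
    exact R.symm.continuous.comp_continuousOn h1
  have hum : AEStronglyMeasurable (uncurry w) (volume.restrict (Ioo t₁ 0 ×ˢ univ)) :=
    (hc.mono hstrip).aestronglyMeasurable (measurableSet_Ioo.prod MeasurableSet.univ)
  have hvm : AEStronglyMeasurable (uncurry wR) (volume.restrict (Ioo t₁ 0 ×ˢ univ)) :=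
    (hcR.mono hstrip).aestronglyMeasurable (measurableSet_Ioo.prod MeasurableSet.univ)
  have huM : ∀ τ ∈ Ioo t₁ 0, ∀ x, ‖w τ x‖ ≤ M := fun τ hτ x => (hK τ hτ.2 x).trans (le_max_left _ _)
  have hvM : ∀ τ ∈ Ioo t₁ 0, ∀ x, ‖wR τ x‖ ≤ M := fun τ hτ x => by
    simp only [hwR, LinearIsometryEquiv.norm_map]
    exact (hK τ hτ.2 (R x)).trans (le_max_left _ _)
  have hu : ∀ τ ∈ Ioo t₁ 0, w τ =ᵐ[volume] fun x =>
      UnboundedOperators.heatExtension (w t₁) (1 * (τ - t₁)) x - oseenDuhamel 1 t₁ w w τ x :=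
    fun τ hτ => Eventually.of_forall fun x => by
      rw [one_mul]
      exact hmild t₁ τ hτ.1 hτ.2 x
  have hv : ∀ τ ∈ Ioo t₁ 0, wR τ =ᵐ[volume] fun x =>
      UnboundedOperators.heatExtension (w t₁) (1 * (τ - t₁)) x - oseenDuhamel 1 t₁ wR wR τ x :=
    fun τ hτ => Eventually.of_forall fun x => by
      rw [one_mul, ← hdatum]
      exact hmildR τ hτ.1 hτ.2 x
  have heq := oseenMild_bounded_unique
    (U := fun τ x => UnboundedOperators.heatExtension (w t₁) (1 * (τ - t₁)) x)
    one_pos hM0 hum hvm huM hvM hu hv t ⟨ht₁t, ht⟩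
  have hwt : w t = wR t := (Continuous.ae_eq_iff_eq volume (hslice t ht) (hsliceR t ht)).1 heq
  -- read off the symmetry at the point `y`
  have key : w t y = rotZ (-θ) (w t (rotZ θ y)) := by
    have := congrFun hwt y
    simpa only [hwR, hR, rotZLIE_symm_apply, rotZLIE_apply] using this
  rw [key, ← rotZ_add, add_neg_cancel, rotZ_zero]

/-! ### Backward propagation by time analyticity -/

/-- **Backward (indeed global) propagation of axisymmetry by joint analyticity.**  If `uncurry w` is real-analytic on
`(−∞,0) × E3` and the slices `w t`, `t₁ < t < 0` (`t₁ < 0`), are axisymmetric, then EVERY slice `w t`, `t < 0`, is: for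
fixed `(θ, y)` the defect `t ↦ w t (R_θ y) − R_θ (w t y)` is real-analytic on the preconnected `(−∞,0)` and vanishes on
the open `(t₁,0)`, hence identically (identity theorem). [folklore] -/
theorem isAxisymmetric_of_analyticOnNhd_of_Ioo {w : ℝ → E3 → E3}
    (han : AnalyticOnNhd ℝ (uncurry w) (Iio (0 : ℝ) ×ˢ (univ : Set E3))) {t₁ : ℝ} (ht₁ : t₁ < 0)
    (hax : ∀ t ∈ Ioo t₁ 0, IsAxisymmetric (w t)) : ∀ t < 0, IsAxisymmetric (w t) := by
  intro t ht θ y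
  set f : ℝ → E3 := fun τ => w τ (rotZ θ y) - rotZ θ (w τ y) with hf
  have hfan : AnalyticOnNhd ℝ f (Iio 0) := by
    intro τ hτ
    have hι1 : AnalyticAt ℝ (fun σ : ℝ => ((σ, rotZ θ y) : ℝ × E3)) τ := analyticAt_id.prod analyticAt_const
    have hι2 : AnalyticAt ℝ (fun σ : ℝ => ((σ, y) : ℝ × E3)) τ := analyticAt_id.prod analyticAt_const
    have h1 : AnalyticAt ℝ (uncurry w ∘ fun σ : ℝ => ((σ, rotZ θ y) : ℝ × E3)) τ :=
      AnalyticAt.comp_of_eq (han (τ, rotZ θ y) ⟨hτ, mem_univ _⟩) hι1 rfl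
    have h2 : AnalyticAt ℝ (uncurry w ∘ fun σ : ℝ => ((σ, y) : ℝ × E3)) τ :=
      AnalyticAt.comp_of_eq (han (τ, y) ⟨hτ, mem_univ _⟩) hι2 rfl
    have h3 : AnalyticAt ℝ (⇑(rotZL θ) ∘ (uncurry w ∘ fun σ : ℝ => ((σ, y) : ℝ × E3))) τ :=
      AnalyticAt.comp_of_eq ((rotZL θ).analyticAt _) h2 rfl
    have h4 := h1.sub h3
    have e : f = (uncurry w ∘ fun σ : ℝ => ((σ, rotZ θ y) : ℝ × E3)) -
        (⇑(rotZL θ) ∘ (uncurry w ∘ fun σ : ℝ => ((σ, y) : ℝ × E3))) := by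
      funext σ
      simp only [hf, Pi.sub_apply, Function.comp_apply, uncurry_apply_pair, rotZL_apply]
    rw [e]
    exact h4
  have hz₀ : t₁ / 2 ∈ Iio (0 : ℝ) := by
    show t₁ / 2 < 0
    linarith
  have hfz : f =ᶠ[𝓝 (t₁ / 2)] 0 := by
    filter_upwards [isOpen_Ioo.mem_nhds (show t₁ / 2 ∈ Ioo t₁ 0 from ⟨by linarith, by linarith⟩)] with τ hτ
    simp only [hf, Pi.zero_apply, hax τ hτ θ y, sub_self]
  have h0 := hfan.eqOn_zero_of_preconnected_of_eventuallyEq_zero isPreconnected_Iio hz₀ hfz (mem_Iio.2 ht)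
  simp only [hf, Pi.zero_apply, sub_eq_zero] at h0
  exact h0

/-! ### The Oseen-mild class under a constant boost followed by a translation -/

/-- **Constant Galilean boost + translation stays in the Oseen-mild class.**  If `w` is continuous and uniformly bounded
on `(−∞,0) × E3`, weakly divergence free on every slice and pointwise Oseen-mild for all `s < t < 0`, then so is
`w₂ t y = w t (y + a + t • c) − c` (`Theorems.stub_oseen_const_boost` for the boost, translation covariance of the heat
semigroup and of the Oseen bilinear term for the shift). [folklore] -/
theorem oseenMild_boost_translate {w : ℝ → E3 → E3}
    (hc : ContinuousOn (uncurry w) (Iio 0 ×ˢ univ)) (hK : ∃ K : ℝ, ∀ t < 0, ∀ x, ‖w t x‖ ≤ K)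
    (hdiv : ∀ t < 0, IsWeaklyDivFree (w t))
    (hmild : ∀ s t : ℝ, s < t → t < 0 → ∀ x,
      w t x = UnboundedOperators.heatExtension (w s) (t - s) x - oseenDuhamel 1 s w w t x)
    (a c : E3) :
    ContinuousOn (uncurry fun t y => w t (y + a + t • c) - c) (Iio 0 ×ˢ univ) ∧
    (∃ K : ℝ, ∀ t < 0, ∀ x, ‖(fun t y => w t (y + a + t • c) - c) t x‖ ≤ K) ∧
    (∀ t < 0, IsWeaklyDivFree ((fun t y => w t (y + a + t • c) - c) t)) ∧
    (∀ s t : ℝ, s < t → t < 0 → ∀ x,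
      (fun t y => w t (y + a + t • c) - c) t x =
        UnboundedOperators.heatExtension ((fun t y => w t (y + a + t • c) - c) s) (t - s) x -
          oseenDuhamel 1 s (fun t y => w t (y + a + t • c) - c) (fun t y => w t (y + a + t • c) - c) t x) := by
  obtain ⟨hcb, hKb, hdivb, hmildb⟩ := Theorems.stub_oseen_const_boost w c hc hK hdiv hmild
  -- the boosted field and its translate
  set wb : ℝ → E3 → E3 := fun t y => w t (y + t • c) - c with hwb
  have hw₂ : (fun t y => w t (y + a + t • c) - c) = fun t y => wb t (y + a) := by
    funext t y
    simp only [hwb, add_assoc]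
  rw [hw₂]
  refine ⟨?_, ?_, ?_, ?_⟩
  · exact hcb.comp (continuous_fst.prodMk (continuous_snd.add continuous_const)).continuousOn
      fun p hp => ⟨hp.1, mem_univ _⟩
  · obtain ⟨Kb, hKb⟩ := hKb
    exact ⟨Kb, fun t ht x => hKb t ht (x + a)⟩
  · intro t ht
    exact (hdivb t ht).comp_add_right' a
  · intro s t hst ht x
    have h1 := hmildb s t hst ht (x + a)
    have h2 := heatExtension_comp_add_right_apply (wb s) a (t - s) x
    have h3 := oseenDuhamel_comp_add_right 1 s wb wb a t x
    simp only at h1 ⊢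
    rw [h2, h3]
    exact h1

/-- `B¹_s` only sees the slices strictly between `s` and `t`. [folklore] -/
theorem oseenDuhamel_congr_Ioo {s t : ℝ} {u u' : ℝ → E3 → E3} (h : ∀ τ ∈ Ioo s t, u τ = u' τ) (x : E3) :
    oseenDuhamel 1 s u u t x = oseenDuhamel 1 s u' u' t x := by
  rw [oseenDuhamel_apply, oseenDuhamel_apply]
  refine setIntegral_congr_fun measurableSet_Ioo fun τ hτ => ?_
  simp only [h τ hτ]

end GalileanPropagation

open GalileanPropagation

/-- **(I2″) `GalileanAxisymmetryPropagates`** (silent-shells sketch v1.4 l.866, body verbatim): in the duality-form class of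
bounded ancient mild solutions with a.e.-measurable slices, jointly smooth on `(−∞,0) × E3`, axisymmetry of ONE slice
propagates to ALL slices after a time-dependent Galilean change of gauge `(t, x) ↦ v t (x + A t) − c t` that stays in the
class.  Oseen gauge ⊕ constant boost absorbing the horizontal part of the gauge constant at `t₁` ⊕ forward uniqueness under
rotation covariance ⊕ backward identity theorem from joint analyticity mod gauge (HH-0⁺, p700714). [folklore] -/
theorem galileanAxisymmetryPropagates :
    ∀ v : ℝ → E3 → E3, IsBoundedAncientMildSolution 1 v →
      (∀ t < 0, AEStronglyMeasurable (v t) volume) →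
      ContDiffOn ℝ (⊤ : ℕ∞) (Function.uncurry v) (Set.Iio 0 ×ˢ Set.univ) →
      (∃ t₁ < 0, IsAxisymmetric (v t₁)) →
      ∃ A c : ℝ → E3,
        IsBoundedAncientMildSolution 1 (fun t x => v t (x + A t) - c t) ∧
        (∀ t < 0, AEStronglyMeasurable (fun x => v t (x + A t) - c t) volume) ∧
        ∀ t < 0, IsAxisymmetric (fun x => v t (x + A t) - c t) := by
  intro v hv hmeas hsmooth ht₁
  obtain ⟨t₁, ht₁, hax₁⟩ := ht₁
  obtain ⟨w, A₀, c₀, hwm, hwc, ⟨K, hK⟩, hwdiv, hwmild, -, hrep⟩ :=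
    Theorems.oseen_gauge_of_aestronglyMeasurable v hv hmeas
  -- slices are continuous; the Galilean representation holds everywhere
  have hwslice : ∀ t < 0, Continuous (w t) := fun t ht =>
    hwc.comp_continuous (Continuous.prodMk_right t) fun x => ⟨ht, mem_univ _⟩
  have hvslice : ∀ t < 0, Continuous (v t) := fun t ht =>
    hsmooth.continuousOn.comp_continuous (Continuous.prodMk_right t) fun x => ⟨ht, mem_univ _⟩
  have hrep' : ∀ t < 0, ∀ x, v t x = w t (x - A₀ t) + c₀ t := by
    intro t ht
    have hrhs : Continuous fun x : E3 => w t (x - A₀ t) + c₀ t :=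
      ((hwslice t ht).comp (continuous_id.sub continuous_const)).add continuous_const
    have heq : v t = fun x => w t (x - A₀ t) + c₀ t :=
      (Continuous.ae_eq_iff_eq volume (hvslice t ht) hrhs).1 (hrep t ht)
    exact fun x => congrFun heq x
  -- split the gauge constant at `t₁` into its axial and horizontal parts
  set cpar : E3 := EuclideanSpace.single 2 (c₀ t₁ 2) with hcpar
  set cperp : E3 := c₀ t₁ - cpar with hcperp
  -- the boosted–translated gauge field and the gauge change
  set a : E3 := -A₀ t₁ + t₁ • cperp with ha
  set w₂ : ℝ → E3 → E3 := fun t y => w t (y + a + t • (-cperp)) - (-cperp) with hw₂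
  set A : ℝ → E3 := fun t => A₀ t - A₀ t₁ + (t₁ - t) • cperp with hA
  set c : ℝ → E3 := fun t => c₀ t - cperp with hcdef
  refine ⟨A, c, ?_⟩
  -- the gauge-changed field IS `w₂` on every negative slice
  have hu₂ : ∀ t < 0, (fun x => v t (x + A t) - c t) = w₂ t := by
    intro t ht
    funext x
    simp only [hw₂, hA, hcdef]
    rw [hrep' t ht]
    have harg : x + (A₀ t - A₀ t₁ + (t₁ - t) • cperp) - A₀ t = x + a + t • -cperp := by
      rw [ha, sub_smul, smul_neg]
      abel
    rw [harg]
    abel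
  -- `w₂` is in the Oseen-mild class
  obtain ⟨hc₂, ⟨K₂, hK₂⟩, hdiv₂, hmild₂⟩ :=
    oseenMild_boost_translate hwc ⟨K, hK⟩ hwdiv hwmild a (-cperp)
  have hw₂slice : ∀ t < 0, Continuous (w₂ t) := fun t ht =>
    hc₂.comp_continuous (Continuous.prodMk_right t) fun x => ⟨ht, mem_univ _⟩
  -- `w₂ t₁ = v t₁ − c∥` is axisymmetric
  have hw₂t₁ : w₂ t₁ = fun x => v t₁ x - cpar := by
    funext x
    simp only [hw₂]
    rw [hrep' t₁ ht₁ x]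
    have harg : x + a + t₁ • -cperp = x - A₀ t₁ := by
      rw [ha, smul_neg]
      abel
    rw [harg, hcperp]
    abel
  have hax₂t₁ : IsAxisymmetric (w₂ t₁) := by
    rw [hw₂t₁]
    exact isAxisymmetric_sub_single hax₁ _
  -- forward: `t₁ < t < 0`
  have hfwd : ∀ t ∈ Ioo t₁ 0, IsAxisymmetric (w₂ t) := fun t ht =>
    isAxisymmetric_forward_of_oseenMild hc₂ hK₂ hmild₂ hax₂t₁ ht.1 ht.2
  -- joint analyticity of `w₂` from that of the gauge field (HH-0⁺ key lemma)
  have hanw : AnalyticOnNhd ℝ (uncurry w) (Iio (0 : ℝ) ×ˢ (univ : Set E3)) :=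
    CellFlux.oseenGauge_analyticOnNhd_uncurry hwm hwc hK hwmild
  have hanw₂ : AnalyticOnNhd ℝ (uncurry w₂) (Iio (0 : ℝ) ×ˢ (univ : Set E3)) := by
    set g : ℝ × E3 → ℝ × E3 := fun p => (p.1, p.2 + a + p.1 • (-cperp)) with hg
    have hgan : AnalyticOnNhd ℝ g univ := by
      intro p _
      exact analyticAt_fst.prod ((analyticAt_snd.add analyticAt_const).add (analyticAt_fst.smul analyticAt_const))
    have hmaps : MapsTo g (Iio (0 : ℝ) ×ˢ (univ : Set E3)) (Iio (0 : ℝ) ×ˢ (univ : Set E3)) :=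
      fun p hp => ⟨hp.1, mem_univ _⟩
    have hcomp := (hanw.comp (hgan.mono (subset_univ _)) hmaps).sub
      (analyticOnNhd_const (v := -cperp))
    have e : uncurry w₂ = fun p => (uncurry w ∘ g) p - -cperp := by
      funext p
      rfl
    rw [e]
    exact hcomp
  -- all slices
  have hall : ∀ t < 0, IsAxisymmetric (w₂ t) := isAxisymmetric_of_analyticOnNhd_of_Ioo hanw₂ ht₁ hfwd
  refine ⟨?_, fun t ht => ?_, fun t ht => ?_⟩
  · -- class membership: Lemarié-Rieusset Thm 6.1 for the Oseen-mild field, transported along `hu₂`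
    refine isBoundedAncientMildSolution_of_oseen one_pos ?_ ⟨K₂, fun t ht x => ?_⟩ (fun t ht => ?_) ?_
    · refine hc₂.congr fun p hp => ?_
      obtain ⟨t, x⟩ := p
      have ht : t < 0 := hp.1
      show v t (x + A t) - c t = w₂ t x
      exact congrFun (hu₂ t ht) x
    · have e := congrFun (hu₂ t ht) x
      show ‖v t (x + A t) - c t‖ ≤ K₂
      rw [e]
      exact hK₂ t ht x
    · show IsWeaklyDivFree (fun x => v t (x + A t) - c t)
      rw [hu₂ t ht]
      exact hdiv₂ t ht
    · intro s t hst ht x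
      have hs : s < 0 := hst.trans ht
      have e := congrFun (hu₂ t ht) x
      show v t (x + A t) - c t =
        UnboundedOperators.heatExtension (fun x => v s (x + A s) - c s) (1 * (t - s)) x -
          oseenDuhamel 1 s (fun t x => v t (x + A t) - c t) (fun t x => v t (x + A t) - c t) t x
      rw [one_mul, e, hu₂ s hs,
        oseenDuhamel_congr_Ioo (u := fun t x => v t (x + A t) - c t) (u' := w₂)
          (fun τ hτ => hu₂ τ (hτ.2.trans ht)) x]
      exact hmild₂ s t hst ht x
  · show AEStronglyMeasurable (fun x => v t (x + A t) - c t) volume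
    rw [hu₂ t ht]
    exact (hw₂slice t ht).aestronglyMeasurable
  · show IsAxisymmetric (fun x => v t (x + A t) - c t)
    rw [hu₂ t ht]
    exact hall t ht

end Summit.NavierStokesRegularity.NavierStokesRegularity.Theorems.PoloidalLiouville.SilentShells
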